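import Mathlib
import HarnessLib

/-!
# HANDOFF — THE REFLECTION FORM: the atom of `q` on a section is «locally-even energy minus locally-odd energy» of the layer
# (cell rh-explicit, TRACK «HANDOFF», seat theory-2 gen13; FILE XII-ι; the abstract identity behind cc-s2-5 g10's exact formula
# `N[g] = −σ·(log q/√q)·Σ_m (−1)^m a_{E−1,m}²` and behind XII-ε/XII-ε′'s value-term / slope-term expansion)

HONEST FRAMING. Nothing here bears on the truth of RH; this is finite-dimensional inner-product algebra. On the handoff window the
atom of the new prime `q` acts on a test function only through the LAYER `[m − δ, m + δ]`, `m = (log q)/2`, via the reflection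
pairing `∫_{−δ}^{δ} G(m + s)·G(m − s) ds = ⟪G, R G⟫` with `R` the reflection about `m` (XII-ε `contribution_eq_neg_mul_re_layerIntegral`;
cc-s2-5's section identity). If `G` lies in the span of an orthonormal family `e_i` of `R`-eigenvectors with signs `ε_i = ±1`
(orthonormal Legendre polynomials on the layer: `ε_m = (−1)^m`), then `⟪G, R G⟫ = Σ_i ε_i a_i²` — the locally-EVEN energy minus the
locally-ODD energy (`inner_reflection_eq_sum_sign_mul_sq`, `…_eq_evenEnergy_sub_oddEnergy`). So: an odd-sector vector is rewarded by
the atom in proportion to the excess of its locally-even layer energy (DATA, theory-2 gen13 LADDER (L16): the wall bottoms keep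
`E_odd/E_even = 0.10–0.12` at q = 29…43); an even-sector vector, charged on its value, is rewarded iff its layer is net locally-odd
(`E_odd/E_even = 1.7–2.2` on the certified even wall vectors — the node near the entrance point); and `|⟪G, RG⟫| ≤ ‖G‖²_layer`
(`abs_inner_reflection_le`) is the section face of XII-h's cap. RH-free, per vector. Folklore (Parseval with a ±1 multiplier).
-/

set_option linter.dupNamespace false  -- the mandated namespace repeats `RiemannHypothesis`

open Finset
open scoped RealInnerProductSpace

namespace Summit.RiemannHypothesis.RiemannHypothesis.Theorems.HandoffReflectionForm

variable {V : Type*} [NormedAddCommGroup V] [InnerProductSpace ℝ V] {ι : Type*} [Fintype ι]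

/-- **THE REFLECTION FORM IN AN ADAPTED ORTHONORMAL BASIS.** Let `e : ι → V` be orthonormal and `R : V →ₗ[ℝ] V` act on it by signs,
`R (e i) = ε i • e i`. For `G = Σ_i a_i • e_i`: `⟪G, R G⟫ = Σ_i ε_i·a_i²`. (Orthonormal Legendre polynomials on the layer and the
reflection about its centre: `ε_m = (−1)^m` — cc-s2-5's section identity for the atom of `q`.) [folklore: Parseval] -/
theorem inner_reflection_eq_sum_sign_mul_sq {e : ι → V} (he : Orthonormal ℝ e) {R : V →ₗ[ℝ] V} {ε : ι → ℝ}
    (hR : ∀ i, R (e i) = ε i • e i) (a : ι → ℝ) :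
    ⟪∑ i, a i • e i, R (∑ i, a i • e i)⟫ = ∑ i, ε i * a i ^ 2 := by
  have hRG : R (∑ i, a i • e i) = ∑ i, (ε i * a i) • e i := by
    rw [map_sum]
    refine Finset.sum_congr rfl fun i _ ↦ ?_
    rw [map_smul, hR i, smul_smul, mul_comm]
  rw [hRG, he.inner_sum]
  refine Finset.sum_congr rfl fun i _ ↦ ?_
  simp only [conj_trivial]
  ring

/-- **= LOCALLY-EVEN ENERGY MINUS LOCALLY-ODD ENERGY.** With signs `ε_i ∈ {1, −1}`: `⟪G, RG⟫ = Σ_{ε_i = 1} a_i² − Σ_{ε_i = −1} a_i²`.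
[folklore] -/
theorem inner_reflection_eq_evenEnergy_sub_oddEnergy [DecidableEq ι] {e : ι → V} (he : Orthonormal ℝ e) {R : V →ₗ[ℝ] V}
    {ε : ι → ℝ} (hR : ∀ i, R (e i) = ε i • e i) (hε : ∀ i, ε i = 1 ∨ ε i = -1) (a : ι → ℝ) :
    ⟪∑ i, a i • e i, R (∑ i, a i • e i)⟫
      = (∑ i ∈ univ.filter (fun i ↦ ε i = 1), a i ^ 2) - ∑ i ∈ univ.filter (fun i ↦ ε i = -1), a i ^ 2 := by
  rw [inner_reflection_eq_sum_sign_mul_sq he hR, Finset.sum_filter, Finset.sum_filter, ← Finset.sum_sub_distrib]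
  refine Finset.sum_congr rfl fun i _ ↦ ?_
  rcases hε i with h | h
  · rw [if_pos h, if_neg (by rw [h]; norm_num), h]; ring
  · rw [if_neg (by rw [h]; norm_num), if_pos h, h]; ring

/-- The layer energy itself: `‖G‖² = Σ_i a_i²` (Parseval), the sum of the even and the odd energies. [folklore] -/
theorem norm_sq_eq_sum_sq {e : ι → V} (he : Orthonormal ℝ e) (a : ι → ℝ) :
    ‖∑ i, a i • e i‖ ^ 2 = ∑ i, a i ^ 2 := by
  rw [← real_inner_self_eq_norm_sq, he.inner_sum]
  refine Finset.sum_congr rfl fun i _ ↦ ?_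
  simp only [conj_trivial]; ring

/-- **THE CAP, SECTION FACE.** With signs `±1`: `|⟪G, RG⟫| ≤ ‖G‖²` — the reflection form never exceeds the layer energy (the
section version of XII-h `abs_contribution_le`: |contribution| ≤ cap·‖g‖², equality iff `G` is purely locally-even or purely
locally-odd on the layer). [folklore] -/
theorem abs_inner_reflection_le {e : ι → V} (he : Orthonormal ℝ e) {R : V →ₗ[ℝ] V} {ε : ι → ℝ}
    (hR : ∀ i, R (e i) = ε i • e i) (hε : ∀ i, ε i = 1 ∨ ε i = -1) (a : ι → ℝ) :
    |⟪∑ i, a i • e i, R (∑ i, a i • e i)⟫| ≤ ‖∑ i, a i • e i‖ ^ 2 := by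
  rw [inner_reflection_eq_sum_sign_mul_sq he hR, norm_sq_eq_sum_sq he]
  refine (Finset.abs_sum_le_sum_abs _ _).trans (Finset.sum_le_sum fun i _ ↦ ?_)
  rcases hε i with h | h <;> rw [h] <;> simp [abs_of_nonneg (sq_nonneg (a i))]

/-- **SIGN RULE.** With signs `±1`: the reflection form is `≥ 0` iff the locally-even energy is at least the locally-odd energy.
(The cell's odd wall bottoms: `E_odd/E_even ≈ 0.10–0.12` — rewarded; its even wall vectors: `≈ 1.7–2.2` — net locally-odd, so the
even atom's charge on the value becomes a reward on the slope.) [folklore; the cell's reading] -/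
theorem inner_reflection_nonneg_iff [DecidableEq ι] {e : ι → V} (he : Orthonormal ℝ e) {R : V →ₗ[ℝ] V} {ε : ι → ℝ}
    (hR : ∀ i, R (e i) = ε i • e i) (hε : ∀ i, ε i = 1 ∨ ε i = -1) (a : ι → ℝ) :
    0 ≤ ⟪∑ i, a i • e i, R (∑ i, a i • e i)⟫ ↔
      ∑ i ∈ univ.filter (fun i ↦ ε i = -1), a i ^ 2 ≤ ∑ i ∈ univ.filter (fun i ↦ ε i = 1), a i ^ 2 := by
  rw [inner_reflection_eq_evenEnergy_sub_oddEnergy he hR hε, sub_nonneg]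

end Summit.RiemannHypothesis.RiemannHypothesis.Theorems.HandoffReflectionForm

/-!
## §2 (theory-2 gen14) THE LINEAR LAYER AND THE SIGNATURE OF THE EVEN ATOM

The algebra under two laws read this session (HOME/handoff/theory-2/LADDER.md v1.16 (L18)(L19); DATA, single-lineage):
* (L18) the reflection integral of an edge profile `F(s) = α + β s` over the layer `[0, 2δ]` (read inward from the edge) is
  `2δα² + 4δ²αβ + (4/3)δ³β² = E_even − E_odd` with `E_even = 2δ(α + βδ)²`, `E_odd = (2/3)β²δ³`; holding `α, β` RIGID while the
  layer widens, the log-derivative `δ I′/I` is `(1 + 4x + 2x²)/(1 + 2x + (2/3)x²)` in `x = βδ/α` (the «rigid exponent»), which rises monotonically from `1`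
  (flat layer) toward `3` (profile pinned at zero) — the shape of the «rigid curve» (2.66 at 0.8e-4 → 3.15 at 1.2e-4 on the K29 cell; its
  LEVEL is then lowered by the measured relaxation `ρ(δ)`); and a node-less linear layer always has `E_odd/E_even ≤ 1/3` (the odd full-form
  modes read 0.29 → 0.19), so a layer with `E_odd/E_even = 1.75` (the even wall vector) is NOT of this kind — it has a node (at 0.75 δ).
* (L19) on the even near-null ladder the atom is `−C·(η⊗η ∘ M)` with `M = 𝟙𝟙ᵀ + c(g𝟙ᵀ + 𝟙gᵀ) + B·g gᵀ` on steep node-less shapes; on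
  `span{𝟙, g}` its quadratic form is the binary form `a² + 2c·ab + B·b²`, which is INDEFINITE iff `B < c²` — for power shapes
  `c = 1/(ν+1)`, `B = Β(ν+1, ν+1)` and `B < c²` is Chebyshev's anti-correlation of `u^ν` and `(1−u)^ν` (classical; not proved here) — so
  the even atom on its ladder has exactly one direction of each sign: one pushes every rung up in the deleted form, the other is the wall.
RH-free; ring / order arithmetic. Folklore.
-/

namespace Summit.RiemannHypothesis.RiemannHypothesis.Theorems.HandoffReflectionForm

open intervalIntegral

/-- **THE LINEAR LAYER, REFLECTION INTEGRAL.** For the edge profile `F(s) = α + β s` on the layer `[0, 2δ]`: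
`∫₀^{2δ} F(s)·F(2δ − s) ds = 2δα² + 4δ²αβ + (4/3)δ³β²`. [folklore: a cubic's antiderivative] -/
theorem layer_reflection_integral_linear (α β δ : ℝ) :
    ∫ s in (0 : ℝ)..2 * δ, (α + β * s) * (α + β * (2 * δ - s)) = 2 * δ * α ^ 2 + 4 * δ ^ 2 * α * β + 4 / 3 * δ ^ 3 * β ^ 2 := by
  have hderiv : ∀ s ∈ Set.uIcc (0 : ℝ) (2 * δ),
      HasDerivAt (fun s : ℝ ↦ (α ^ 2 + 2 * α * β * δ) * s + β ^ 2 * δ * s ^ 2 - β ^ 2 / 3 * s ^ 3)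
        ((α + β * s) * (α + β * (2 * δ - s))) s := by
    intro s _
    have h1 : HasDerivAt (fun s : ℝ ↦ s) 1 s := hasDerivAt_id s
    have h2 : HasDerivAt (fun s : ℝ ↦ s ^ 2) (2 * s) s := by simpa using hasDerivAt_pow 2 s
    have h3 : HasDerivAt (fun s : ℝ ↦ s ^ 3) (3 * s ^ 2) s := by simpa using hasDerivAt_pow 3 s
    have h := ((h1.const_mul (α ^ 2 + 2 * α * β * δ)).add (h2.const_mul (β ^ 2 * δ))).sub (h3.const_mul (β ^ 2 / 3))
    have hf : (fun s : ℝ ↦ (α ^ 2 + 2 * α * β * δ) * s + β ^ 2 * δ * s ^ 2 - β ^ 2 / 3 * s ^ 3)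
        = fun s : ℝ ↦ (α ^ 2 + 2 * α * β * δ) * (fun s : ℝ ↦ s) s + β ^ 2 * δ * (fun s : ℝ ↦ s ^ 2) s
            - β ^ 2 / 3 * (fun s : ℝ ↦ s ^ 3) s := by
      funext s; ring
    rw [hf]
    exact h.congr_deriv (by ring)
  have hint : IntervalIntegrable (fun s : ℝ ↦ (α + β * s) * (α + β * (2 * δ - s))) MeasureTheory.volume 0 (2 * δ) :=
    (by fun_prop : Continuous fun s : ℝ ↦ (α + β * s) * (α + β * (2 * δ - s))).intervalIntegrable _ _
  rw [integral_eq_sub_of_hasDerivAt hderiv hint]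
  ring

/-- **= E_even − E_odd for the linear layer.** About the layer midpoint the profile is `(α + βδ) + β·t`, `t ∈ [−δ, δ]`; its locally-even
energy is `E_even = 2δ(α + βδ)²`, its locally-odd energy `E_odd = (2/3)β²δ³`, and the reflection integral is their difference. [folklore] -/
theorem layer_reflection_linear_eq_even_sub_odd (α β δ : ℝ) :
    2 * δ * α ^ 2 + 4 * δ ^ 2 * α * β + 4 / 3 * δ ^ 3 * β ^ 2 = 2 * δ * (α + β * δ) ^ 2 - 2 / 3 * β ^ 2 * δ ^ 3 := by
  ring

/-- **A NODE-LESS LINEAR LAYER IS LOCALLY EVEN-DOMINATED:** `E_odd ≤ E_even/3`, i.e. `(2/3)β²δ³ ≤ (1/3)·2δ(α + βδ)²` whenever the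
profile keeps one sign on the layer (`0 ≤ α·(α + 2βδ)`, the values at the two ends have the same sign) and `0 ≤ δ`. So a layer with
`E_odd/E_even = 1.75` (the certified even wall vector) changes sign inside the layer. [folklore] -/
theorem oddEnergy_le_third_evenEnergy {α β δ : ℝ} (hδ : 0 ≤ δ) (hsign : 0 ≤ α * (α + 2 * β * δ)) :
    2 / 3 * β ^ 2 * δ ^ 3 ≤ 1 / 3 * (2 * δ * (α + β * δ) ^ 2) := by
  have h : 1 / 3 * (2 * δ * (α + β * δ) ^ 2) - 2 / 3 * β ^ 2 * δ ^ 3 = 2 / 3 * δ * (α * (α + 2 * β * δ)) := by ring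
  nlinarith [mul_nonneg hδ hsign]

/-- THE RIGID-PROFILE LOG-DERIVATIVE of the linear layer's reflection integral. With `α, β` fixed and `I(δ) = 2δα² + 4δ²αβ + (4/3)δ³β²`,
`δ·I′(δ) = 2δα² + 8δ²αβ + 4δ³β²`, so `δ I′/I = (1 + 4x + 2x²)/(1 + 2x + (2/3)x²)` in `x = βδ/α` — the «rigid exponent» of the three
theorems below. Here the identity `δ·I′(δ)·(denominator) = I(δ)·(numerator)`, written without division. [calculus, ring] -/
theorem rigidExponent_identity (α β δ : ℝ) :
    (2 * δ * α ^ 2 + 8 * δ ^ 2 * α * β + 4 * δ ^ 3 * β ^ 2) * (α ^ 2 + 2 * α * (β * δ) + 2 / 3 * (β * δ) ^ 2)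
      = (2 * δ * α ^ 2 + 4 * δ ^ 2 * α * β + 4 / 3 * δ ^ 3 * β ^ 2) * (α ^ 2 + 4 * α * (β * δ) + 2 * (β * δ) ^ 2) := by
  ring

/-- `I′` really is the derivative: `d/dδ [2δα² + 4δ²αβ + (4/3)δ³β²] = 2α² + 8δαβ + 4δ²β²`. [calculus] -/
theorem hasDerivAt_layer_reflection_linear (α β δ : ℝ) :
    HasDerivAt (fun d : ℝ ↦ 2 * d * α ^ 2 + 4 * d ^ 2 * α * β + 4 / 3 * d ^ 3 * β ^ 2)
      (2 * α ^ 2 + 8 * δ * α * β + 4 * δ ^ 2 * β ^ 2) δ := by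
  have h1 : HasDerivAt (fun d : ℝ ↦ d) 1 δ := hasDerivAt_id δ
  have h2 : HasDerivAt (fun d : ℝ ↦ d ^ 2) (2 * δ) δ := by simpa using hasDerivAt_pow 2 δ
  have h3 : HasDerivAt (fun d : ℝ ↦ d ^ 3) (3 * δ ^ 2) δ := by simpa using hasDerivAt_pow 3 δ
  have h := ((h1.const_mul (2 * α ^ 2)).add (h2.const_mul (4 * α * β))).add (h3.const_mul (4 / 3 * β ^ 2))
  have hf : (fun d : ℝ ↦ 2 * d * α ^ 2 + 4 * d ^ 2 * α * β + 4 / 3 * d ^ 3 * β ^ 2)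
      = fun d : ℝ ↦ 2 * α ^ 2 * (fun d : ℝ ↦ d) d + 4 * α * β * (fun d : ℝ ↦ d ^ 2) d + 4 / 3 * β ^ 2 * (fun d : ℝ ↦ d ^ 3) d := by
    funext d; ring
  rw [hf]
  exact h.congr_deriv (by ring)

/-- **THE RIGID EXPONENT STARTS AT 1:** `1 ≤ (1 + 4x + 2x²)/(1 + 2x + (2/3)x²)` for `x ≥ 0` (a flat layer, `x = 0`, gives exactly `1`). [order arithmetic] -/
theorem one_le_rigidExponent {x : ℝ} (hx : 0 ≤ x) : 1 ≤ (1 + 4 * x + 2 * x ^ 2) / (1 + 2 * x + 2 / 3 * x ^ 2) := by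
  rw [le_div_iff₀ (by positivity)]
  nlinarith [sq_nonneg x]

/-- **… AND NEVER REACHES 3:** the rigid exponent is `< 3` for `x ≥ 0` (the limit `x → ∞`, a profile pinned at zero at the edge, is `3`: the
pure `δ³` law of a linear rise from zero). [order arithmetic] -/
theorem rigidExponent_lt_three {x : ℝ} (hx : 0 ≤ x) : (1 + 4 * x + 2 * x ^ 2) / (1 + 2 * x + 2 / 3 * x ^ 2) < 3 := by
  rw [div_lt_iff₀ (by positivity)]
  nlinarith [sq_nonneg x]

/-- **… MONOTONICALLY:** the rigid exponent is monotone on `[0, ∞)` — the rigid-profile exponent RISES as the layer widens (`x = βδ/α ∝ δ`):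
the convex-in-δ «rigid curve» of LADDER (L18)(R1) (2.66 → 3.15 over δ = 0.8 … 1.25e-4 on the K29 p80 cell). The difference of cross
products factors as `(y − x)·(2 + (4/3)(x + y) + (4/3)xy)`. [order arithmetic] -/
theorem rigidExponent_mono {x y : ℝ} (hx : 0 ≤ x) (hxy : x ≤ y) :
    (1 + 4 * x + 2 * x ^ 2) / (1 + 2 * x + 2 / 3 * x ^ 2) ≤ (1 + 4 * y + 2 * y ^ 2) / (1 + 2 * y + 2 / 3 * y ^ 2) := by
  have hy : 0 ≤ y := hx.trans hxy
  rw [div_le_div_iff₀ (by positivity) (by positivity)]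
  have key : (1 + 4 * y + 2 * y ^ 2) * (1 + 2 * x + 2 / 3 * x ^ 2) - (1 + 4 * x + 2 * x ^ 2) * (1 + 2 * y + 2 / 3 * y ^ 2)
      = (y - x) * (2 + 4 / 3 * (x + y) + 4 / 3 * (x * y)) := by ring
  nlinarith [mul_nonneg (sub_nonneg.2 hxy) (by positivity : (0 : ℝ) ≤ 2 + 4 / 3 * (x + y) + 4 / 3 * (x * y))]

/-- **THE SIGNATURE OF THE EVEN ATOM, form level.** The binary form `a² + 2c·ab + B·b²` (the even atom's Gram on `span{𝟙, g}` up to the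
factor `−C`, with `c = ⟨edge shape⟩`-cross coefficient and `B` the end-to-end product coefficient) takes a NEGATIVE value as soon as
`B < c²`: at `(a, b) = (−c, 1)` it equals `B − c²`. With the positive value `1` at `(1, 0)` the form is indefinite — one direction of
each sign. [folklore: discriminant] -/
theorem binaryForm_neg_of_lt_sq {c B : ℝ} (h : B < c ^ 2) : ∃ a b : ℝ, a ^ 2 + 2 * c * (a * b) + B * b ^ 2 < 0 :=
  ⟨-c, 1, by nlinarith⟩

/-- The same form is positive at `(1, 0)`; together with `binaryForm_neg_of_lt_sq`: INDEFINITE when `B < c²`. [trivial] -/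
theorem binaryForm_pos_at_one_zero (c B : ℝ) : 0 < (1 : ℝ) ^ 2 + 2 * c * (1 * 0) + B * 0 ^ 2 := by
  norm_num

/-- Conversely, when `c² ≤ B` the form is a sum of squares, `(a + c b)² + (B − c²) b² ≥ 0`: no negative direction (the odd ladder's
case in the cell's reading: there the atom on the ladder is one-signed and the tail-capacity rule XII-η applies). [folklore] -/
theorem binaryForm_nonneg_of_sq_le {c B : ℝ} (h : c ^ 2 ≤ B) (a b : ℝ) : 0 ≤ a ^ 2 + 2 * c * (a * b) + B * b ^ 2 := by
  nlinarith [sq_nonneg (a + c * b), mul_nonneg (sub_nonneg.2 h) (sq_nonneg b)]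

/-- **GRAM FORM ON A TWO-VECTOR SPAN.** In a real inner-product space, for the rank-≤2 operator with quadratic form
`x ↦ ⟪x,u⟫² + 2c⟪x,u⟫⟪x,w⟫ + B⟪x,w⟫²` (the even atom's `𝟙𝟙ᵀ + c(g𝟙ᵀ + 𝟙gᵀ) + B ggᵀ` with `u = 𝟙`, `w = g`): if some vector `x`
realises `⟪x,u⟫ = −c·t`, `⟪x,w⟫ = t` with `t ≠ 0` (possible whenever `u, w` are linearly independent) and `B < c²`, the form is negative
at `x`. [folklore] -/
theorem gramForm_neg_of_lt_sq {W : Type*} [NormedAddCommGroup W] [InnerProductSpace ℝ W] {u w x : W} {c B t : ℝ}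
    (h : B < c ^ 2) (ht : t ≠ 0) (hu : ⟪x, u⟫ = -c * t) (hw : ⟪x, w⟫ = t) :
    ⟪x, u⟫ ^ 2 + 2 * c * (⟪x, u⟫ * ⟪x, w⟫) + B * ⟪x, w⟫ ^ 2 < 0 := by
  rw [hu, hw]
  have ht2 : 0 < t ^ 2 := by positivity
  nlinarith [mul_pos (sub_pos.2 h) ht2]

end Summit.RiemannHypothesis.RiemannHypothesis.Theorems.HandoffReflectionForm

/-!
## §3 (theory-2 gen14) THE POWER-SHAPE GRAM IS NEVER POSITIVE DEFINITE: `Β(ν+1, ν+1) ≤ (ν+1)⁻²`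

For the power family `φ = 1 + g u^ν` of §2 the end-to-end coefficient is `B = Β(ν+1, ν+1) = Γ(ν+1)²/Γ(2ν+2)` and the cross
coefficient is `c = 1/(ν+1)`; the signature criterion `B < c²` of §2 is Chebyshev's anti-correlation of `u^ν` and `(1−u)^ν`. Here the
NON-STRICT half, which is log-convexity of `Γ` between `2` and `2ν + 2` (Mathlib's Hölder form): `Γ(ν+2)² ≤ Γ(2)·Γ(2ν+2) = Γ(2ν+2)`,
hence `Γ(ν+1)²·(ν+1)² ≤ Γ(2ν+2)` — the Gram of §2 has a non-positive direction for every `ν ≥ 0` (strictness for `ν > 0`, i.e. a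
genuinely NEGATIVE direction, is classical strict log-convexity and is checked numerically in the cell's LADDER (L19′): the shape Gram of the
twelve measured profiles has spectrum `{12.1, −0.117, |rest| < 1e−6}`). RH-free. [folklore: Bohr–Mollerup / Hölder]
-/

namespace Summit.RiemannHypothesis.RiemannHypothesis.Theorems.HandoffReflectionForm

/-- **Log-convexity of Γ between 2 and 2ν+2:** `Γ(ν+2)² ≤ Γ(2ν+2)` for `ν ≥ 0` (midpoint form of Mathlib's
`Real.Gamma_mul_add_mul_le_rpow_Gamma_mul_rpow_Gamma` with `Γ(2) = 1`). [folklore] -/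
theorem Gamma_add_two_sq_le (ν : ℝ) (hν : 0 ≤ ν) : Real.Gamma (ν + 2) ^ 2 ≤ Real.Gamma (2 * ν + 2) := by
  have ht : (0 : ℝ) < 2 * ν + 2 := by linarith
  have h := Real.Gamma_mul_add_mul_le_rpow_Gamma_mul_rpow_Gamma (s := 2) (t := 2 * ν + 2) (a := 1 / 2) (b := 1 / 2)
    two_pos ht one_half_pos one_half_pos (by norm_num)
  have e : (1 : ℝ) / 2 * 2 + 1 / 2 * (2 * ν + 2) = ν + 2 := by ring
  rw [e, Real.Gamma_two, Real.one_rpow, one_mul] at h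
  have hG : 0 ≤ Real.Gamma (ν + 2) := (Real.Gamma_pos_of_pos (by linarith)).le
  have hT : 0 ≤ Real.Gamma (2 * ν + 2) := (Real.Gamma_pos_of_pos ht).le
  calc Real.Gamma (ν + 2) ^ 2 ≤ (Real.Gamma (2 * ν + 2) ^ (1 / 2 : ℝ)) ^ 2 := pow_le_pow_left₀ hG h 2
    _ = Real.Gamma (2 * ν + 2) := by
        rw [← Real.rpow_natCast, ← Real.rpow_mul hT]; norm_num

/-- **The Beta form:** `Γ(ν+1)²·(ν+1)² ≤ Γ(2ν+2)`, i.e. `Β(ν+1,ν+1) = Γ(ν+1)²/Γ(2ν+2) ≤ 1/(ν+1)²` — the power-shape Gram of §2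
(`c = 1/(ν+1)`, `B = Β(ν+1,ν+1)`) satisfies `B ≤ c²` for every `ν ≥ 0`: never positive definite. [folklore] -/
theorem Gamma_add_one_sq_mul_sq_le (ν : ℝ) (hν : 0 ≤ ν) :
    Real.Gamma (ν + 1) ^ 2 * (ν + 1) ^ 2 ≤ Real.Gamma (2 * ν + 2) := by
  have h1 : Real.Gamma (ν + 2) = (ν + 1) * Real.Gamma (ν + 1) := by
    rw [show ν + 2 = (ν + 1) + 1 by ring, Real.Gamma_add_one (by linarith)]
  have h := Gamma_add_two_sq_le ν hν
  rw [h1] at h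
  nlinarith [h]

/-- The same as a bound on the Beta quotient: `Γ(ν+1)²/Γ(2ν+2) ≤ ((ν+1)²)⁻¹`. [folklore] -/
theorem betaQuotient_le_inv_sq (ν : ℝ) (hν : 0 ≤ ν) :
    Real.Gamma (ν + 1) ^ 2 / Real.Gamma (2 * ν + 2) ≤ ((ν + 1) ^ 2)⁻¹ := by
  have hT : 0 < Real.Gamma (2 * ν + 2) := Real.Gamma_pos_of_pos (by linarith)
  have hn : 0 < (ν + 1) ^ 2 := by positivity
  rw [div_le_iff₀ hT]
  calc Real.Gamma (ν + 1) ^ 2 = ((ν + 1) ^ 2)⁻¹ * (Real.Gamma (ν + 1) ^ 2 * (ν + 1) ^ 2) := by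
        field_simp
    _ ≤ ((ν + 1) ^ 2)⁻¹ * Real.Gamma (2 * ν + 2) :=
        mul_le_mul_of_nonneg_left (Gamma_add_one_sq_mul_sq_le ν hν) (inv_nonneg.2 hn.le)

end Summit.RiemannHypothesis.RiemannHypothesis.Theorems.HandoffReflectionForm

/-!
## §4 (theory-2 gen14) NO EVEN WALL WITHOUT SHAPE CONTRAST

The cell's even-sector wall mechanism (LADDER (L19)–(L19‴)): on the near-null ladder the deleted form is `diag(λ_k) + 2C·(η_j η_k Q_jk)` with
`Q_jk = ∫ Φ_j(s) Φ_k(2δ − s) ds` the reflection Gram of the rungs' edge SHAPES. If all rungs had the SAME shape, `Q_jk = Q₀₀` for all `j, k`, the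
added term would be the rank-one positive semidefinite `2C·Q₀₀·(η⊗η)`, and a positive diagonal plus such a term has NO negative direction: the even
wall exists only because the shapes differ (the (+,−) signature of §2/§3). Here the finite-dimensional statement, RH-free: `Σ λ_i b_i² + c·(Σ u_i b_i)² > 0`
for `λ_i > 0`, `c ≥ 0`, `b ≠ 0`. (Its odd mirror — a positive diagonal MINUS a rank-one term is indefinite iff the secular capacity exceeds one —
is XII-x `exists_neg_eigenvalue_iff`.) [folklore]
-/

namespace Summit.RiemannHypothesis.RiemannHypothesis.Theorems.HandoffReflectionForm

/-- **NO NEGATIVE DIRECTION FROM A ONE-SHAPE ATOM.** For positive rung energies `λ_i`, any `c ≥ 0` and any coefficient vector `b ≠ 0`: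
`0 < Σ_i λ_i b_i² + c·(Σ_i u_i b_i)²` — a positive diagonal plus a positive-semidefinite rank-one term is positive definite. In the cell's reading:
if every even near-null mode had the same edge shape, the deleted even form would have no wall at any bandwidth. [folklore] -/
theorem diag_add_rankOne_pos {n : ℕ} {lam u b : Fin n → ℝ} {c : ℝ} (hlam : ∀ i, 0 < lam i) (hc : 0 ≤ c)
    (hb : b ≠ 0) : 0 < (∑ i, lam i * b i ^ 2) + c * (∑ i, u i * b i) ^ 2 := by
  obtain ⟨j, hj⟩ : ∃ j, b j ≠ 0 := Function.ne_iff.mp hb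
  have h1 : 0 < ∑ i, lam i * b i ^ 2 := by
    apply Finset.sum_pos'
    · intro i _
      exact mul_nonneg (hlam i).le (sq_nonneg _)
    · exact ⟨j, Finset.mem_univ j, mul_pos (hlam j) (by positivity)⟩
  have h2 : 0 ≤ c * (∑ i, u i * b i) ^ 2 := mul_nonneg hc (sq_nonneg _)
  linarith

/-- The same with the rank-one term SUBTRACTED but too weak: if `c·Σ_i u_i²/λ_i < 1` (the odd sector's secular capacity below one) then the
form `Σ λ_i b_i² − c(Σ u_i b_i)²` is still positive for `b ≠ 0` — Cauchy–Schwarz with weights `λ_i`: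
`(Σ u_i b_i)² ≤ (Σ u_i²/λ_i)(Σ λ_i b_i²)`. (Companion to XII-x; stated here so that both sectors' «no wall» conditions sit beside the
signature criterion of §2.) [folklore: weighted Cauchy–Schwarz] -/
theorem diag_sub_rankOne_pos_of_capacity_lt_one {n : ℕ} {lam u b : Fin n → ℝ} {c : ℝ} (hlam : ∀ i, 0 < lam i) (hc : 0 ≤ c)
    (hcap : c * ∑ i, u i ^ 2 / lam i < 1) (hb : b ≠ 0) :
    0 < (∑ i, lam i * b i ^ 2) - c * (∑ i, u i * b i) ^ 2 := by
  obtain ⟨j, hj⟩ : ∃ j, b j ≠ 0 := Function.ne_iff.mp hb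
  have hE : 0 < ∑ i, lam i * b i ^ 2 := by
    apply Finset.sum_pos'
    · intro i _
      exact mul_nonneg (hlam i).le (sq_nonneg _)
    · exact ⟨j, Finset.mem_univ j, mul_pos (hlam j) (by positivity)⟩
  -- weighted Cauchy–Schwarz: (Σ u b)² ≤ (Σ u²/λ)(Σ λ b²)
  have hCS : (∑ i, u i * b i) ^ 2 ≤ (∑ i, u i ^ 2 / lam i) * ∑ i, lam i * b i ^ 2 := by
    have key := Finset.sum_mul_sq_le_sq_mul_sq Finset.univ (fun i ↦ u i / Real.sqrt (lam i)) (fun i ↦ Real.sqrt (lam i) * b i)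
    have e1 : ∀ i, u i / Real.sqrt (lam i) * (Real.sqrt (lam i) * b i) = u i * b i := by
      intro i
      have hs : Real.sqrt (lam i) ≠ 0 := (Real.sqrt_pos.2 (hlam i)).ne'
      field_simp
    have e2 : ∀ i, (u i / Real.sqrt (lam i)) ^ 2 = u i ^ 2 / lam i := by
      intro i
      rw [div_pow, Real.sq_sqrt (hlam i).le]
    have e3 : ∀ i, (Real.sqrt (lam i) * b i) ^ 2 = lam i * b i ^ 2 := by
      intro i
      rw [mul_pow, Real.sq_sqrt (hlam i).le]
    simp only [e1, e2, e3] at key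
    exact key
  have hS : 0 ≤ ∑ i, u i ^ 2 / lam i := Finset.sum_nonneg fun i _ ↦ div_nonneg (sq_nonneg _) (hlam i).le
  nlinarith [mul_le_mul_of_nonneg_left hCS hc, mul_lt_mul_of_pos_right hcap hE]

end Summit.RiemannHypothesis.RiemannHypothesis.Theorems.HandoffReflectionForm
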